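import Summits.BirchSwinnertonDyer.Rank1Residual.X5.TwoAdicTargetsMultKatoInt
import Literature.NumberTheory.EllipticCurves.Zhai2021.TwoAdicLowerBoundTwists
import HarnessLib

/-!
# Route ByReductionTypeAtTwo, crux `MultUpperHalfAtTwo` (stmt-BirchSwinnertonDyer-19922) — two further CLOSED
# `Prop` leaves for the layer-3 split (Theses-free module, importable by the route file): the
# integral-Kato door for every curve, and the residual OFF the three roads

Companion of `ByReductionTypeAtTwoMultUpperHalfDefs.lean` (p420550; leaves `GreenbergStevensAtSplitTwo`,
`KatoRatAtMultTwo`, `IntegralKatoAtOptimalMultTwo`, `UpperHalfOffRoadAtMultTwo`) for the reduction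
`Theorems.multUpperHalfAtTwo_of_katoInt_of_optimalMuZero_of_offRoads` (seat `bsd-2adic-mult-2` GEN 2,
file `ByReductionTypeAtTwoMultUpperHalfKatoInt.lean`): that theorem carries two binders the p420550 leaves
do not name — the door T-KATO2-NSMULT for every curve (`hKint`) and the SMALLER residual `hoff` (optimal
curves off the `μ = 0` road, off the Prop-5.14 road AND off the door's locus «non-split ∧
`TwoAdicSurjective` ∧ `Δ < 0`»). Each constant below is the corresponding binder VERBATIM (`@[conjecture]`,
nothing asserted); `Iff.rfl` lemmas record that nothing was changed; this module imports no Theses file, so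
a route file can import it (pattern of `ByReductionTypeAtTwoOrdHalvesDefs.lean`). The glue term is one
application of the landed theorem (its binder types unfold to these constants by `rfl`).

HONEST FRAMING (cell `bsd-2adic`): typed targets only; nothing asserted, nothing booked; BSD is not proved
by any of this. PARTITION: X5@2 mult (K4ᵐ, B1·O1; 1 976 classes) × p = 2 — types-the-object-of; closes none.
-/

set_option autoImplicit false
set_option linter.dupNamespace false

noncomputable section

open scoped Classical MatrixGroups ModularForm

open CongruenceSubgroup WeierstrassCurve Literature.NumberTheory.EllipticCurves
  Literature.NumberTheory.EllipticCurves.ModularForms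
  Literature.NumberTheory.EllipticCurves.Greenberg1999
  Literature.NumberTheory.EllipticCurves.Rank1Residual
  Literature.NumberTheory.EllipticCurves.Rank1Residual.Typed
  Summit.BirchSwinnertonDyer.Rank1Residual.X5

namespace Summit.BirchSwinnertonDyer.BirchSwinnertonDyer.Theorems.MultUpperHalvesAtTwo

/-- [crux, MEMO] **T-KATO2-NSMULT for every curve** — the binder `hKint` of
`Theorems.multUpperHalfAtTwo_of_katoInt_of_optimalMuZero_of_offRoads`: the displayed statement
`O1.KatoDivisibilityAtTwoNonsplitMultInt W` (kernel p419632) for every globally minimal elliptic `W/ℚ` —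
Kato's divisibility `char_Λ X(E/ℚ_∞) ∋ L₀`, `ι L₀ = ϖ·L`, IN `Λ = ℤ₂⟦T⟧` with the `2`-power part, for `W`
NON-SPLIT multiplicative at `2` with `ρ_{E,2^∞}(G_ℚ) = GL₂(ℤ₂)` and `Δ_W < 0` (vacuous off that guard).
Memo-proved in the cell (HOME mult/PROOF-KATO2MULT.md v1 Thm. A, transport of the reserve's refereed W_K2
via Rubin's `Λ`-adic Thm. II.3.8; referee pending), NOT in print (Kato Thm. 17.4 assumes `p ∤ N`; 17.13 at
`p ∣ N` is `⊗ℚ`; Skinner 2016 keeps `p ≥ 3`). Nothing asserted.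
[cite: Kato2004Asterisque, Prop. 17.11–Lemma 17.12 and Thm. 17.13 (pp. 277–280), Thm. 16.6 (p. 271) (shape)]
[cite: Rubin2000, Thm. II.3.8 (shape)] -/
@[conjecture] def KatoIntAtNonsplitSurjectiveTwo : Prop :=
  ∀ (W : WeierstrassCurve ℚ) [W.IsElliptic] [W.IsGloballyMinimal], O1.KatoDivisibilityAtTwoNonsplitMultInt W

/-- [crux, RESIDUAL] **The upper half OFF the three roads** — the binder `hoff` of
`Theorems.multUpperHalfAtTwo_of_katoInt_of_optimalMuZero_of_offRoads` VERBATIM: `MissingUpperBoundAt W₀ 2`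
for every `X₀(N)`-optimal globally minimal non-CM `W₀` of analytic rank `0` multiplicative at `2`
(lattice-optimal parametrisation datum at level `N_{W₀}`) that is (i) off the `μ = 0` road (cyclotomic `μ`
not known to vanish), (ii) off the Prop-5.14 road (no rational `2`-torsion point ramified-XOR-odd) and
(iii) off the locus of the door T-KATO2-NSMULT (NOT: non-split at `2` ∧ `TwoAdicSurjective W₀` ∧
`Δ_{W₀} < 0`). Expected content: split-multiplicative, non-surjective or positive-discriminant irreducible
classes whose optimal curve carries no `μ`-certificate, and the «neither» classes (unique rational
`2`-torsion point neither ramified nor odd, cf. 195A1 in Greenberg's LNM 1716 p. 124) — there the `μ`-part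
of Kato's divisibility at `2`, resp. a split / small-image integral Euler-system argument at `2`, is needed
(not in print). Strictly smaller than `UpperHalfOffRoadAtMultTwo` (p420550). Nothing asserted.
[cite: GreenbergLNM1716, Prop. 5.13, Prop. 5.14 (pp. 120–122) and p. 124 (shape)] [cite: Miller2011LMS, Def. 1.1] -/
@[conjecture] def UpperHalfOffRoadsAtMultTwo : Prop :=
  ∀ (W₀ : WeierstrassCurve ℚ) [W₀.IsElliptic] [W₀.IsGloballyMinimal]
    [NeZero (W₀.conductorNorm ℤ)], ¬ W₀.HasCM → W₀.analyticRank = 0 → Mult W₀ 2 →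
    ∀ D₀ : ModularParametrizationData W₀ (W₀.conductorNorm ℤ), Zhai2021.IsOptimalDatum W₀ D₀ →
    (¬ ∀ (κ : ZpExtension ℚ 2) (γ : Field.absoluteGaloisGroup ℚ), κ.IsCyclotomic →
        κ.IsTopGenerator γ → IsCyclotomicVariable 2 γ → ∀ D : W₀.SelmerDualData κ γ, D.mu = 0) →
    (¬ ∃ x y : ℚ, W₀.toAffine.Equation x y ∧ 2 * y + W₀.a₁ * x + W₀.a₃ = 0 ∧
        ((TwoTorsionRamifiedAtTwo x ∧ ¬ TwoTorsionOdd W₀ x) ∨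
          (TwoTorsionOdd W₀ x ∧ ¬ TwoTorsionRamifiedAtTwo x))) →
    ¬ (¬ W₀.HasSplitMultiplicativeReductionAtPrime 2 ∧ O1.TwoAdicSurjective W₀ ∧ W₀.Δ < 0) →
    MissingUpperBoundAt W₀ 2

/-! ## Bookkeeping: the constants unfold to the binders verbatim -/

/-- `KatoIntAtNonsplitSurjectiveTwo` unfolds to the binder `hKint`. [folklore] -/
theorem katoIntAtNonsplitSurjectiveTwo_iff : KatoIntAtNonsplitSurjectiveTwo ↔
    ∀ (W : WeierstrassCurve ℚ) [W.IsElliptic] [W.IsGloballyMinimal],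
      O1.KatoDivisibilityAtTwoNonsplitMultInt W :=
  Iff.rfl

/-- `UpperHalfOffRoadsAtMultTwo` unfolds to the binder `hoff`. [folklore] -/
theorem upperHalfOffRoadsAtMultTwo_iff : UpperHalfOffRoadsAtMultTwo ↔
    ∀ (W₀ : WeierstrassCurve ℚ) [W₀.IsElliptic] [W₀.IsGloballyMinimal]
      [NeZero (W₀.conductorNorm ℤ)], ¬ W₀.HasCM → W₀.analyticRank = 0 → Mult W₀ 2 →
      ∀ D₀ : ModularParametrizationData W₀ (W₀.conductorNorm ℤ), Zhai2021.IsOptimalDatum W₀ D₀ →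
      (¬ ∀ (κ : ZpExtension ℚ 2) (γ : Field.absoluteGaloisGroup ℚ), κ.IsCyclotomic →
          κ.IsTopGenerator γ → IsCyclotomicVariable 2 γ → ∀ D : W₀.SelmerDualData κ γ, D.mu = 0) →
      (¬ ∃ x y : ℚ, W₀.toAffine.Equation x y ∧ 2 * y + W₀.a₁ * x + W₀.a₃ = 0 ∧
          ((TwoTorsionRamifiedAtTwo x ∧ ¬ TwoTorsionOdd W₀ x) ∨
            (TwoTorsionOdd W₀ x ∧ ¬ TwoTorsionRamifiedAtTwo x))) →
      ¬ (¬ W₀.HasSplitMultiplicativeReductionAtPrime 2 ∧ O1.TwoAdicSurjective W₀ ∧ W₀.Δ < 0) →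
      MissingUpperBoundAt W₀ 2 :=
  Iff.rfl

/-- **The new residual is contained in the old one**: `UpperHalfOffRoadAtMultTwo` (p420550: off the `μ = 0`
and Prop-5.14 roads) implies `UpperHalfOffRoadsAtMultTwo` (off those AND off the door's locus) — the extra
hypothesis is simply dropped. Bookkeeping for the planner: replacing the residual leaf by the new one is a
weakening of what the route still needs. [folklore] -/
theorem upperHalfOffRoadsAtMultTwo_of_offRoad
    (hoff : ∀ (W₀ : WeierstrassCurve ℚ) [W₀.IsElliptic] [W₀.IsGloballyMinimal]
      [NeZero (W₀.conductorNorm ℤ)], ¬ W₀.HasCM → W₀.analyticRank = 0 → Mult W₀ 2 →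
      ∀ D₀ : ModularParametrizationData W₀ (W₀.conductorNorm ℤ), Zhai2021.IsOptimalDatum W₀ D₀ →
      (¬ ∀ (κ : ZpExtension ℚ 2) (γ : Field.absoluteGaloisGroup ℚ), κ.IsCyclotomic →
          κ.IsTopGenerator γ → IsCyclotomicVariable 2 γ → ∀ D : W₀.SelmerDualData κ γ, D.mu = 0) →
      (¬ ∃ x y : ℚ, W₀.toAffine.Equation x y ∧ 2 * y + W₀.a₁ * x + W₀.a₃ = 0 ∧
          ((TwoTorsionRamifiedAtTwo x ∧ ¬ TwoTorsionOdd W₀ x) ∨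
            (TwoTorsionOdd W₀ x ∧ ¬ TwoTorsionRamifiedAtTwo x))) →
      MissingUpperBoundAt W₀ 2) :
    UpperHalfOffRoadsAtMultTwo :=
  fun W₀ _ _ _ hcm hr hmult D₀ hopt hμ h514 _ ↦ hoff W₀ hcm hr hmult D₀ hopt hμ h514

/-! ## Appended (same seat, GEN 2): the slack-one door and the residual off FOUR roads -/

/-- [crux, MEMO] **T-KATO2-NSMULT at slack ONE for every curve (the tree's G1 at `k = 1`)** — the binder `hK1`
of `Theorems.multUpperHalfAtTwo_of_fourRoads`: for every globally minimal elliptic `W/ℚ`, every level `N`,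
every `f` and every `L`, `O1.KatoDivisibilityAtTwoMultUpTo W 1 f (-1) L` (`X5/TwoAdicTargetsB.lean`; its
guards `Mult W 2`, non-split via `α = −1`, `IsNewformOf W f`, `IsMultPAdicLFunctionOf f 2 (-1) L`,
`O1.TwoAdicSurjective W` sit inside, so the statement is vacuous off the locus «non-split multiplicative at
`2`, `ρ_{E,2^∞}` surjective»): `X` torsion and `2ⁿ·L = ι g`, `g ∈ char_Λ X`, for some `n ≤ 1`. This is
PROOF-KATO2MULT Thm. A (`char X ∣ L₂^{Ω⁺_E}`, both signs of `Δ`) in the tree's currency: §4.7 Cor. C (ii)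
«on 𝓔𝓔₂^{ns} G1 holds at `k = ord₂ c_∞(E) ∈ {0 (Δ < 0), 1 (Δ > 0)}` with `m = 0`», and `k = 0 ⇒ k = 1`
(`katoDivisibilityAtTwoMultUpTo_mono`). Memo-proved (referee pending), NOT in print. Nothing asserted.
[cite: Kato2004Asterisque, Prop. 17.11–Lemma 17.12 and Thm. 17.13 (pp. 277–280) (shape)]
[cite: MazurTateTeitelbaum1986Invent, §I.10 and §I.14 (the object)] -/
@[conjecture] def KatoUpToOneAtNonsplitSurjectiveTwo : Prop :=
  ∀ (W : WeierstrassCurve ℚ) [W.IsElliptic] [W.IsGloballyMinimal] {N : ℕ} [NeZero N]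
    (f : CuspForm (Gamma0 N) 2) (L : PowerSeries ℚ_[2]), O1.KatoDivisibilityAtTwoMultUpTo W 1 f (-1) L

/-- [crux, RESIDUAL] **The upper half OFF the four roads** — the binder `hoff` of
`Theorems.multUpperHalfAtTwo_of_fourRoads` VERBATIM: `MissingUpperBoundAt W₀ 2` for every `X₀(N)`-optimal
globally minimal non-CM `W₀` of analytic rank `0` multiplicative at `2` (lattice-optimal parametrisation datum
at level `N_{W₀}`) that is (i) off the `μ = 0` road, (ii) off the Prop-5.14 road, (iii) off the locus of the
sharp door (NOT: non-split ∧ `TwoAdicSurjective` ∧ `Δ < 0`) and (iv) off the PARITY road (NOT: non-split ∧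
`TwoAdicSurjective` ∧ `#Ш_an(W₀) = q ∈ ℚ` with `ord₂ q` even — the last conjunct is decidable per curve and
holds wherever BSD does; at `Δ > 0` it is what recovers the power of `2` the slack-one door loses, by
Cassels–Tate). Expected content: the split-multiplicative and small-image irreducible classes without a
`μ`-certificate and the «neither» classes. Strictly smaller than `UpperHalfOffRoadsAtMultTwo`. Nothing asserted.
[cite: GreenbergLNM1716, Prop. 5.13, Prop. 5.14 (pp. 120–122) and p. 124 (shape)] [cite: Miller2011LMS, Def. 1.1]
[cite: SilvermanAEC2009, Thm. X.4.14 (square order of Ш; shape)] -/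
@[conjecture] def UpperHalfOffFourRoadsAtMultTwo : Prop :=
  ∀ (W₀ : WeierstrassCurve ℚ) [W₀.IsElliptic] [W₀.IsGloballyMinimal]
    [NeZero (W₀.conductorNorm ℤ)], ¬ W₀.HasCM → W₀.analyticRank = 0 → Mult W₀ 2 →
    ∀ D₀ : ModularParametrizationData W₀ (W₀.conductorNorm ℤ), Zhai2021.IsOptimalDatum W₀ D₀ →
    (¬ ∀ (κ : ZpExtension ℚ 2) (γ : Field.absoluteGaloisGroup ℚ), κ.IsCyclotomic →
        κ.IsTopGenerator γ → IsCyclotomicVariable 2 γ → ∀ D : W₀.SelmerDualData κ γ, D.mu = 0) →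
    (¬ ∃ x y : ℚ, W₀.toAffine.Equation x y ∧ 2 * y + W₀.a₁ * x + W₀.a₃ = 0 ∧
        ((TwoTorsionRamifiedAtTwo x ∧ ¬ TwoTorsionOdd W₀ x) ∨
          (TwoTorsionOdd W₀ x ∧ ¬ TwoTorsionRamifiedAtTwo x))) →
    ¬ (¬ W₀.HasSplitMultiplicativeReductionAtPrime 2 ∧ O1.TwoAdicSurjective W₀ ∧ W₀.Δ < 0) →
    ¬ (¬ W₀.HasSplitMultiplicativeReductionAtPrime 2 ∧ O1.TwoAdicSurjective W₀ ∧
        ∃ q : ℚ, shaAn W₀ = (q : ℂ) ∧ Even (padicValRat 2 q)) →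
    MissingUpperBoundAt W₀ 2

/-- `KatoUpToOneAtNonsplitSurjectiveTwo` unfolds to the binder `hK1`. [folklore] -/
theorem katoUpToOneAtNonsplitSurjectiveTwo_iff : KatoUpToOneAtNonsplitSurjectiveTwo ↔
    ∀ (W : WeierstrassCurve ℚ) [W.IsElliptic] [W.IsGloballyMinimal] {N : ℕ} [NeZero N]
      (f : CuspForm (Gamma0 N) 2) (L : PowerSeries ℚ_[2]), O1.KatoDivisibilityAtTwoMultUpTo W 1 f (-1) L :=
  Iff.rfl

/-- **The four-road residual is contained in the three-road one**: `UpperHalfOffRoadsAtMultTwo` implies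
`UpperHalfOffFourRoadsAtMultTwo` (the parity hypothesis is dropped). [folklore] -/
theorem upperHalfOffFourRoadsAtMultTwo_of_offRoads (h : UpperHalfOffRoadsAtMultTwo) :
    UpperHalfOffFourRoadsAtMultTwo :=
  fun W₀ _ _ _ hcm hr hmult D₀ hopt hμ h514 hdoor _ ↦ h W₀ hcm hr hmult D₀ hopt hμ h514 hdoor

end Summit.BirchSwinnertonDyer.BirchSwinnertonDyer.Theorems.MultUpperHalvesAtTwo

end
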